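import Literature.NumberTheory.Automorphic.HeckeFixedVectorsSimple
import Literature.NumberTheory.Automorphic.HeckeFixedVectorsLift
import Literature.RingTheory.SimpleModule.MultiplicityFreeCommutant
import HarnessLib

/-!
# Multiplicity one ⇒ the commutant of the Hecke operators on `V^K` is commutative

Topic `NumberTheory/Automorphic`; generic sequel to `HeckeFixedVectorsSimple` (`V^K` is a simple module over
the Hecke operators `[KgK]` of an irreducible `ρ`, Bump Prop. 4.2.3 / Bushnell–Henniart §4.3) and to the pure
algebra file `RingTheory/SimpleModule/MultiplicityFreeCommutant` («the commutant of a multiplicity-free family of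
operators is commutative», Bourbaki A VIII §4 n°6 / Schur).  Everything here is PROVED (no definition, no named
fact); it is the representation-theoretic HEAD that the CM-Albanese road of the cell `hodgecm-mathlib` (line T5′,
«VI-1 ⇐ H413 + HD3 by the multiplicity-one lever») consumes at a finite level `K`:

> if a representation `(ρ, V)` of `G` decomposes `G`-equivariantly as a direct sum `V ≃ ⊕_t W_t` of IRREDUCIBLE
> representations `(σ_t, W_t)` whose spaces of `K`-fixed vectors are pairwise *Hecke-disjoint* (every
> Hecke-equivariant linear map `W_s^K → W_t^K`, `s ≠ t`, vanishes — for `σ_s ≇ σ_t` this is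
> `HeckeFixedVectorsLift.eq_zero_of_heckeEquivariant_of_isEmpty_equiv`, Bushnell–Henniart §4.3 Cor.), and `V^K`
> is finite-dimensional, then any two endomorphisms of `V^K` commuting with all Hecke operators `[KgK]` commute
> with each other.

This is the classical sentence «multiplicity one for the `K`-spherical constituents makes the Hecke commutant on
`V^K` commutative» (Goodman–Wallach, proof of Lemma 4.1.18: the commutant of a direct sum of pairwise
inequivalent irreducibles preserves each summand and acts on it by scalars; Bushnell–Henniart §4.3 Proposition:
`V ↦ V^K` carries irreducibles with `V^K ≠ 0` to simple `ℋ(G,K)`-modules), stated for an ARBITRARY model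
`(E, b, T)` of `V^K` chosen by the consumer: an injection `b : E → V` with image `V^K` and operators `T g` on `E`
with `b ∘ T g = [KgK] ∘ b` (in the application `E = H¹(A_K(ℂ); ℂ)` for the Albanese `A_K` of a Shimura variety at
level `K`, `b` the pull-back to the Betti tower module, `T g` the Hecke correspondence read on `H¹`).

## Main results (all sorry-free; `k` a field of characteristic zero, algebraically closed for the head)

* (private transport lemmas) under a `G`-equivariant `Ψ : V ≃ ⊕_t W_t`, `v ∈ V^K` iff every component
  `(Ψ v)_t ∈ W_t^K`, and `(Ψ ([KgK]_ρ v))_t = [KgK]_{σ_t} ((Ψ v)_t)` for `v ∈ V^K` (finite double coset).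
* `commute_of_forall_commute_heckeOperator_of_directSum` — THE HEAD described above, for a consumer's model
  `(E, b, T)` of `V^K`; `centralizer_range_comm_of_directSum` — the same read on Mathlib's
  `Subalgebra.centralizer k (Set.range T)`.
* `commute_of_forall_commute_heckeOperator_fixedPoints` — the special case `E = V^K`, `T g = [KgK]|_{V^K}`.

Proof of the head: transport along `Φ = Ψ ∘ b : E ↪ ⊕_t W_t` (image `= {x | ∀ t, x_t ∈ W_t^K}`); the subspaces
`E_t := Φ⁻¹(W_t^K)` form an internal direct sum decomposition of `E` into `T`-stable subspaces, pairwise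
`T`-disjoint by `hdisj`, and each non-zero `E_t` is `T`-simple by `eq_fixedPoints_of_heckeOperator_stable`
(irreducibility of `σ_t`); then `MultiplicityFree.commute_of_forall_commute` (scalar blocks over an algebraically
closed field).  No smoothness or admissibility of the `σ_t` is assumed: finite-dimensionality of each `W_t^K` is
inherited from `E`.

## References

* C. J. Bushnell, G. Henniart, *The Local Langlands Conjecture for GL(2)*, Grundlehren 335 (2006), §4.3
  Proposition and Corollary (pp. 38–39) [BushnellHenniart2006].
* D. Bump, *Automorphic Forms and Representations* (1997), Prop. 4.2.3, Thm. 4.6.2 [Bump1997].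
* R. Goodman, N. R. Wallach, *Symmetry, Representations, and Invariants*, GTM 255 (2009), §4.1.2 Lemma 4.1.4
  (Schur) and §4.1.7, proof of Lemma 4.1.18 [GoodmanWallachGTM255].
-/

noncomputable section

open MulAction
open scoped DirectSum

namespace Literature.NumberTheory.Automorphic

/-! ### `K`-fixed vectors and Hecke operators under an equivariant direct-sum decomposition -/

section DirectSumDecomposition

variable {k G V : Type*} [CommRing k] [Group G] [AddCommGroup V] [Module k V]
  {ι : Type*} {W : ι → Type*} [∀ t, AddCommGroup (W t)] [∀ t, Module k (W t)]
  (ρ : Representation k G V) (σ : ∀ t, Representation k G (W t)) (K : Subgroup G)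
  (Ψ : V ≃ₗ[k] ⨁ t, W t) (hΨ : ∀ (g : G) (v : V) (t : ι), Ψ (ρ g v) t = σ t g (Ψ v t))

include hΨ in
/-- Under a `G`-equivariant decomposition `Ψ : V ≃ ⊕_t W_t`, a vector is `K`-fixed iff all its components are
(`(Ψ (ρ g v))_t = σ_t g (Ψ v)_t` and `Ψ` is injective). [folklore] -/
private theorem mem_fixedPoints_iff_forall_apply_mem_fixedPoints (v : V) :
    v ∈ ρ.fixedPoints K ↔ ∀ t, Ψ v t ∈ (σ t).fixedPoints K := by
  constructor
  · intro hv t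
    rw [Representation.mem_fixedPoints]
    intro g hg
    rw [← hΨ, (ρ.mem_fixedPoints K v).1 hv g hg]
  · intro h
    rw [Representation.mem_fixedPoints]
    intro g hg
    apply Ψ.injective
    refine DirectSum.ext (β := fun t => W t) (fun t => ?_)
    rw [hΨ]
    exact ((σ t).mem_fixedPoints K _).1 (h t) g hg

include hΨ in
/-- Under a `G`-equivariant decomposition `Ψ : V ≃ ⊕_t W_t`, the Hecke operator `[KgK]` of a finite double coset
acts componentwise on `K`-fixed vectors: `(Ψ ([KgK]_ρ v))_t = [KgK]_{σ_t} (Ψ v)_t` (both sides are the same finite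
sum `∑_{α ∈ KgK/K} (Ψ (ρ α v))_t = ∑ σ_t α (Ψ v)_t`). [folklore] -/
private theorem apply_heckeOperator_apply {g : G} (hfin : (orbit K (g : G ⧸ K)).Finite) {v : V}
    (hv : v ∈ ρ.fixedPoints K) (t : ι) :
    Ψ (heckeOperator ρ K g v) t = heckeOperator (σ t) K g (Ψ v t) := by
  classical
  have hvt : Ψ v t ∈ (σ t).fixedPoints K :=
    (mem_fixedPoints_iff_forall_apply_mem_fixedPoints ρ σ K Ψ hΨ v).1 hv t
  rw [heckeOperator_apply_eq_sum_out ρ K g hfin hv, heckeOperator_apply_eq_sum_out (σ t) K g hfin hvt,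
    map_sum, DirectSum.apply_eq_component k, map_sum]
  exact Finset.sum_congr rfl fun α _ => by rw [← DirectSum.apply_eq_component, hΨ]

/-- An element of `⊕_t W_t` all of whose components off `t` vanish is `lof t` of its `t`-th component. [folklore] -/
private theorem directSum_eq_lof_apply_of_forall_ne_eq_zero [DecidableEq ι] (x : ⨁ t, W t) (t : ι)
    (h : ∀ s, s ≠ t → x s = 0) : x = DirectSum.lof k ι W t (x t) := by
  refine DirectSum.ext (β := fun t => W t) (fun s => ?_)
  by_cases hs : s = t
  · subst hs
    rw [DirectSum.lof_apply]
  · rw [h s hs, DirectSum.lof_eq_of, DirectSum.of_eq_of_ne _ _ _ hs]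

/-- The components of `lof t w` off `t` vanish and its `t`-th component is `w`; hence `lof t w` has `K`-fixed
components as soon as `w ∈ W_t^K`. [folklore] -/
private theorem lof_apply_mem_fixedPoints [DecidableEq ι] {t : ι} {w : W t} (hw : w ∈ (σ t).fixedPoints K) (s : ι) :
    DirectSum.lof k ι W t w s ∈ (σ s).fixedPoints K := by
  by_cases hs : s = t
  · subst hs
    rwa [DirectSum.lof_apply]
  · rw [DirectSum.lof_eq_of, DirectSum.of_eq_of_ne _ _ _ hs]
    exact Submodule.zero_mem _

end DirectSumDecomposition

/-! ### The head: multiplicity one ⇒ commutative Hecke commutant on `V^K` -/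

section Head

variable {k G V : Type*} [Field k] [CharZero k] [IsAlgClosed k] [Group G] [AddCommGroup V] [Module k V]
  {ι : Type*} {W : ι → Type*} [∀ t, AddCommGroup (W t)] [∀ t, Module k (W t)]
  {E : Type*} [AddCommGroup E] [Module k E] [FiniteDimensional k E]

/-- **Multiplicity one ⇒ the Hecke commutant on `V^K` is commutative.**  Let `K ≤ G` have finite double cosets
(`(orbit K (gK)).Finite`), let `ρ` decompose `G`-equivariantly as `Ψ : V ≃ ⊕_t W_t` with every `σ_t` IRREDUCIBLE, and
suppose the `K`-fixed spaces are pairwise HECKE-DISJOINT: for `s ≠ t` every linear `φ : W_s → W_t` carrying `W_s^K`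
into `W_t^K` Hecke-equivariantly vanishes on `W_s^K` (`hdisj`; e.g. `σ_s ≇ σ_t`, Bushnell–Henniart §4.3 Cor.).  Let
`(E, b, T)` be any model of `V^K` with its Hecke operators: `b : E ↪ V` with image `V^K`, `E` finite-dimensional,
`b (T g e) = [KgK] (b e)`.  Then over an algebraically closed field of characteristic zero any two endomorphisms of
`E` commuting with all `T g` commute.  Proof: `E = ⊕_t E_t`, `E_t := (Ψ ∘ b)⁻¹(W_t^K)`, is an internal direct sum of
`T`-stable, pairwise `T`-disjoint subspaces, each zero or `T`-simple (`eq_fixedPoints_of_heckeOperator_stable`), so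
`MultiplicityFree.commute_of_forall_commute` applies (Schur: the commutant is block-scalar).
[cite: BushnellHenniart2006, §4.3 Proposition and Corollary (pp. 38–39)] [cite: GoodmanWallachGTM255, §4.1.7 Lemma 4.1.18 (proof) and §4.1.2 Lemma 4.1.4]
[cite: Bump1997, Prop. 4.2.3] -/
theorem commute_of_forall_commute_heckeOperator_of_directSum (K : Subgroup G)
    (hfin : ∀ g : G, (orbit K (g : G ⧸ K)).Finite)
    (ρ : Representation k G V) (σ : ∀ t, Representation k G (W t)) [∀ t, (σ t).IsIrreducible]
    (Ψ : V ≃ₗ[k] ⨁ t, W t) (hΨ : ∀ (g : G) (v : V) (t : ι), Ψ (ρ g v) t = σ t g (Ψ v t))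
    (hdisj : ∀ s t, s ≠ t → ∀ φ : W s →ₗ[k] W t,
      (∀ w ∈ (σ s).fixedPoints K, φ w ∈ (σ t).fixedPoints K) →
      (∀ g : G, ∀ w ∈ (σ s).fixedPoints K, φ (heckeOperator (σ s) K g w) = heckeOperator (σ t) K g (φ w)) →
        ∀ w ∈ (σ s).fixedPoints K, φ w = 0)
    (b : E →ₗ[k] V) (hb : Function.Injective b) (hbK : LinearMap.range b = ρ.fixedPoints K)
    (T : G → Module.End k E) (hT : ∀ (g : G) (e : E), b (T g e) = heckeOperator ρ K g (b e))
    {x y : Module.End k E} (hx : ∀ g, x * T g = T g * x) (hy : ∀ g, y * T g = T g * y) :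
    x * y = y * x := by
  classical
  -- the transport map `Φ = Ψ ∘ b : E ↪ ⊕ W_t`, with image the vectors with `K`-fixed components
  set Φ : E →ₗ[k] ⨁ t, W t := Ψ.toLinearMap ∘ₗ b with hΦdef
  have hΦapply : ∀ e, Φ e = Ψ (b e) := fun e => rfl
  have hΦinj : Function.Injective Φ := Ψ.injective.comp hb
  have hbmem : ∀ e, b e ∈ ρ.fixedPoints K := fun e => hbK ▸ LinearMap.mem_range_self b e
  have hΦfix : ∀ e t, Φ e t ∈ (σ t).fixedPoints K := fun e t =>
    (mem_fixedPoints_iff_forall_apply_mem_fixedPoints ρ σ K Ψ hΨ (b e)).1 (hbmem e) t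
  have hΦsurj : ∀ z : ⨁ t, W t, (∀ t, z t ∈ (σ t).fixedPoints K) → ∃ e, Φ e = z := by
    intro z hz
    have hz' : Ψ.symm z ∈ ρ.fixedPoints K :=
      (mem_fixedPoints_iff_forall_apply_mem_fixedPoints ρ σ K Ψ hΨ _).2
        (by simpa only [LinearEquiv.apply_symm_apply] using hz)
    rw [← hbK] at hz'
    obtain ⟨e, he⟩ := hz'
    exact ⟨e, by rw [hΦapply, he, LinearEquiv.apply_symm_apply]⟩
  have hΦT : ∀ g e t, Φ (T g e) t = heckeOperator (σ t) K g (Φ e t) := by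
    intro g e t
    rw [hΦapply, hΦapply, hT]
    exact apply_heckeOperator_apply ρ σ K Ψ hΨ (hfin g) (hbmem e) t
  -- the constituents `E_t = Φ⁻¹(lof t (W_t))`
  let W' : ι → Submodule k E := fun t => (LinearMap.range (DirectSum.lof k ι W t)).comap Φ
  have hmemW' : ∀ {t e}, e ∈ W' t ↔ ∃ w, DirectSum.lof k ι W t w = Φ e := fun {t e} => by
    simp only [W', Submodule.mem_comap, LinearMap.mem_range]
  have hW'zero : ∀ {t e}, e ∈ W' t → ∀ s, s ≠ t → Φ e s = 0 := by
    intro t e he s hs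
    obtain ⟨w, hw⟩ := hmemW'.1 he
    rw [← hw, DirectSum.lof_eq_of, DirectSum.of_eq_of_ne _ _ _ hs]
  have hW'lof : ∀ {t e}, e ∈ W' t → Φ e = DirectSum.lof k ι W t (Φ e t) := fun {t e} he =>
    directSum_eq_lof_apply_of_forall_ne_eq_zero (Φ e) t (hW'zero he)
  have hW'of : ∀ {t e}, (∀ s, s ≠ t → Φ e s = 0) → e ∈ W' t := fun {t e} h =>
    hmemW'.2 ⟨Φ e t, (directSum_eq_lof_apply_of_forall_ne_eq_zero (Φ e) t h).symm⟩
  -- a lift of `lof t w`, `w ∈ W_t^K`, to `E`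
  have hlift : ∀ t, ∀ w ∈ (σ t).fixedPoints K, ∃ e, Φ e = DirectSum.lof k ι W t w := fun t w hw =>
    hΦsurj _ (lof_apply_mem_fixedPoints σ K hw)
  -- (hstab) the `T g` preserve each constituent
  have hstab : ∀ t, ∀ s ∈ Set.range T, ∀ e ∈ W' t, s e ∈ W' t := by
    rintro t _ ⟨g, rfl⟩ e he
    refine hW'of fun s hs => ?_
    rw [hΦT, hW'zero he s hs, map_zero]
  -- (ind) the constituents are independent
  have hind : iSupIndep W' := by
    rw [iSupIndep_def]
    intro t
    rw [Submodule.disjoint_def]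
    intro e het hesup
    have hle : ⨆ (s) (_ : s ≠ t), W' s ≤ LinearMap.ker ((DirectSum.component k ι W t) ∘ₗ Φ) := by
      refine iSup₂_le fun s hs e' he' => ?_
      rw [LinearMap.mem_ker, LinearMap.comp_apply, ← DirectSum.apply_eq_component]
      exact hW'zero he' t (Ne.symm hs)
    have het0 : Φ e t = 0 := by
      have := hle hesup
      rwa [LinearMap.mem_ker, LinearMap.comp_apply, ← DirectSum.apply_eq_component] at this
    apply hΦinj
    rw [hW'lof het, het0, map_zero, map_zero]
  -- (top) the constituents span `E`
  have htop : ⨆ t, W' t = ⊤ := by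
    rw [Submodule.eq_top_iff']
    intro e
    choose f hf using fun t => hlift t (Φ e t) (hΦfix e t)
    have he : e = ∑ t ∈ (Φ e).support, f t := by
      apply hΦinj
      rw [map_sum]
      conv_lhs => rw [← DirectSum.sum_support_of (Φ e)]
      exact Finset.sum_congr rfl fun t _ => by rw [hf t, DirectSum.lof_eq_of]
    rw [he]
    exact Submodule.sum_mem _ fun t _ => Submodule.mem_iSup_of_mem t (hmemW'.2 ⟨_, (hf t).symm⟩)
  -- (hzero) pairwise `T`-disjointness, from `hdisj`
  have hzero : ∀ s t, s ≠ t → ∀ f : Module.End k E, (∀ e ∈ W' s, f e ∈ W' t) →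
      (∀ s' ∈ Set.range T, ∀ e ∈ W' s, f (s' e) = s' (f e)) → ∀ e ∈ W' s, f e = 0 := by
    intro s t hst f hfW hfS
    -- the lift `W_s^K → E`, `w ↦ Φ⁻¹ (lof s w)`, as a linear map
    let ls : (σ s).fixedPoints K →ₗ[k] E :=
      (LinearEquiv.ofInjective Φ hΦinj).symm.toLinearMap ∘ₗ
        LinearMap.codRestrict (LinearMap.range Φ) (DirectSum.lof k ι W s ∘ₗ ((σ s).fixedPoints K).subtype)
          (fun w => by
            obtain ⟨e, he⟩ := hlift s w w.2
            exact ⟨e, he⟩)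
    have hls : ∀ w : (σ s).fixedPoints K, Φ (ls w) = DirectSum.lof k ι W s w := by
      intro w
      simp only [ls, LinearMap.comp_apply, LinearEquiv.coe_coe, LinearEquiv.ofInjective_symm_apply,
        LinearMap.codRestrict_apply, Submodule.coe_subtype]
    have hlsW : ∀ w : (σ s).fixedPoints K, ls w ∈ W' s := fun w => hmemW'.2 ⟨w, (hls w).symm⟩
    have hlsT : ∀ (g : G) (w : (σ s).fixedPoints K),
        ls ⟨heckeOperator (σ s) K g w, heckeOperator_apply_mem_fixedPoints (σ s) K g w.2 (hfin g)⟩ = T g (ls w) := by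
      intro g w
      apply hΦinj
      rw [hls]
      refine DirectSum.ext (β := fun t => W t) (fun u => ?_)
      rw [hΦT]
      by_cases hu : u = s
      · subst hu
        rw [DirectSum.lof_apply, hls, DirectSum.lof_apply]
      · rw [DirectSum.lof_eq_of, DirectSum.of_eq_of_ne _ _ _ hu, hls, DirectSum.lof_eq_of,
          DirectSum.of_eq_of_ne _ _ _ hu, map_zero]
    -- the induced partial map `W_s^K → W_t`, extended to `W_s`
    let φ₀ : (σ s).fixedPoints K →ₗ[k] W t := (DirectSum.component k ι W t) ∘ₗ Φ ∘ₗ f ∘ₗ ls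
    have hφ₀ : ∀ w : (σ s).fixedPoints K, φ₀ w = Φ (f (ls w)) t := fun w => rfl
    obtain ⟨φ, hφ⟩ := LinearMap.exists_extend φ₀
    have hφw : ∀ (w : W s) (hw : w ∈ (σ s).fixedPoints K), φ w = Φ (f (ls ⟨w, hw⟩)) t := by
      intro w hw
      rw [← hφ₀, ← hφ]
      rfl
    have hφK : ∀ w ∈ (σ s).fixedPoints K, φ w ∈ (σ t).fixedPoints K := by
      intro w hw
      rw [hφw w hw]
      exact hΦfix _ _
    have hφT : ∀ g : G, ∀ w ∈ (σ s).fixedPoints K,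
        φ (heckeOperator (σ s) K g w) = heckeOperator (σ t) K g (φ w) := by
      intro g w hw
      rw [hφw _ (heckeOperator_apply_mem_fixedPoints (σ s) K g hw (hfin g)), hφw w hw, hlsT g ⟨w, hw⟩,
        hfS (T g) ⟨g, rfl⟩ _ (hlsW ⟨w, hw⟩), hΦT]
    have hφ0 := hdisj s t hst φ hφK hφT
    -- conclusion on `W' s`
    intro e he
    have hes : Φ e s ∈ (σ s).fixedPoints K := hΦfix e s
    have hel : ls ⟨Φ e s, hes⟩ = e := by
      apply hΦinj
      rw [hls]
      exact (hW'lof he).symm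
    have hft : Φ (f e) t = 0 := by
      have := hφ0 (Φ e s) hes
      rwa [hφw _ hes, hel] at this
    apply hΦinj
    rw [hW'lof (hfW e he), hft, map_zero, map_zero]
  -- (hsimple) each non-zero constituent is `T`-simple, from the irreducibility of `σ_t`
  have hsimple : ∀ t, W' t ≠ ⊥ → ∀ U : Submodule k E, U ≤ W' t → U ≠ ⊥ →
      (∀ s ∈ Set.range T, ∀ e ∈ U, s e ∈ U) → U = W' t := by
    intro t _ U hUle hU0 hUstab
    let π : E →ₗ[k] W t := (DirectSum.component k ι W t) ∘ₗ Φ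
    have hπ : ∀ e, π e = Φ e t := fun e => rfl
    set U' : Submodule k (W t) := U.map π with hU'
    have hU'K : U' ≤ (σ t).fixedPoints K := by
      rintro _ ⟨u, -, rfl⟩
      rw [hπ]
      exact hΦfix u t
    have hU'0 : U' ≠ ⊥ := by
      obtain ⟨u, hu, hu0⟩ := (Submodule.ne_bot_iff U).1 hU0
      refine (Submodule.ne_bot_iff U').2 ⟨π u, Submodule.mem_map_of_mem hu, fun h => hu0 ?_⟩
      apply hΦinj
      rw [hW'lof (hUle hu), ← hπ, h, map_zero, map_zero]
    have hU'stab : ∀ g : G, ∀ w ∈ U', heckeOperator (σ t) K g w ∈ U' := by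
      rintro g _ ⟨u, hu, rfl⟩
      refine ⟨T g u, hUstab (T g) ⟨g, rfl⟩ u hu, ?_⟩
      rw [hπ, hπ, hΦT]
    have hU'eq := eq_fixedPoints_of_heckeOperator_stable (σ t) K hfin hU'K hU'0 hU'stab
    refine le_antisymm hUle fun e he => ?_
    have het : Φ e t ∈ U' := by
      rw [hU'eq]
      exact hΦfix e t
    obtain ⟨u, hu, hue⟩ := het
    have hue' : u = e := by
      apply hΦinj
      rw [hW'lof (hUle hu), hW'lof he, ← hπ u, hue]
    exact hue' ▸ hu
  -- assemble over the non-zero constituents and apply the multiplicity-free commutant theorem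
  have hx' : ∀ s ∈ Set.range T, x * s = s * x := by
    rintro _ ⟨g, rfl⟩
    exact hx g
  have hy' : ∀ s ∈ Set.range T, y * s = s * y := by
    rintro _ ⟨g, rfl⟩
    exact hy g
  exact Literature.RingTheory.SimpleModule.MultiplicityFree.commute_of_forall_commute
    (W := fun t : {t // W' t ≠ ⊥} => W' t.1) (S := Set.range T)
    (hind.comp Subtype.val_injective) (by rw [iSup_ne_bot_subtype, htop])
    (fun t => hstab t.1) (fun i j hij => hzero i.1 j.1 fun h => hij (Subtype.ext h))
    (fun t => ⟨t.2, hsimple t.1 t.2⟩) (fun _ => inferInstance) hx' hy'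

/-- **The Hecke commutant `Subalgebra.centralizer k (range T)` is commutative** — `commute_of_forall_commute_heckeOperator_of_directSum`
read on Mathlib's centraliser subalgebra of the consumer's Hecke operators `T g` on its model `E` of `V^K`.
[cite: BushnellHenniart2006, §4.3 Proposition and Corollary (pp. 38–39)] [cite: GoodmanWallachGTM255, §4.1.7 Lemma 4.1.18 (proof)] -/
theorem centralizer_range_comm_of_directSum (K : Subgroup G)
    (hfin : ∀ g : G, (orbit K (g : G ⧸ K)).Finite)
    (ρ : Representation k G V) (σ : ∀ t, Representation k G (W t)) [∀ t, (σ t).IsIrreducible]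
    (Ψ : V ≃ₗ[k] ⨁ t, W t) (hΨ : ∀ (g : G) (v : V) (t : ι), Ψ (ρ g v) t = σ t g (Ψ v t))
    (hdisj : ∀ s t, s ≠ t → ∀ φ : W s →ₗ[k] W t,
      (∀ w ∈ (σ s).fixedPoints K, φ w ∈ (σ t).fixedPoints K) →
      (∀ g : G, ∀ w ∈ (σ s).fixedPoints K, φ (heckeOperator (σ s) K g w) = heckeOperator (σ t) K g (φ w)) →
        ∀ w ∈ (σ s).fixedPoints K, φ w = 0)
    (b : E →ₗ[k] V) (hb : Function.Injective b) (hbK : LinearMap.range b = ρ.fixedPoints K)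
    (T : G → Module.End k E) (hT : ∀ (g : G) (e : E), b (T g e) = heckeOperator ρ K g (b e)) :
    ∀ x ∈ Subalgebra.centralizer k (Set.range T), ∀ y ∈ Subalgebra.centralizer k (Set.range T),
      x * y = y * x := by
  intro x hx y hy
  rw [Subalgebra.mem_centralizer_iff] at hx hy
  exact commute_of_forall_commute_heckeOperator_of_directSum K hfin ρ σ Ψ hΨ hdisj b hb hbK T hT
    (fun g => (hx (T g) ⟨g, rfl⟩).symm) (fun g => (hy (T g) ⟨g, rfl⟩).symm)

/-- **The case `E = V^K`.**  With `V^K` finite-dimensional, any two endomorphisms of the submodule `V^K = ρ.fixedPoints K`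
commuting with the restricted Hecke operators `[KgK]|_{V^K}` commute, granted the multiplicity-free `G`-decomposition
`Ψ : V ≃ ⊕_t W_t` into irreducibles with pairwise Hecke-disjoint `K`-fixed vectors
(`commute_of_forall_commute_heckeOperator_of_directSum` with `b` the inclusion).
[cite: BushnellHenniart2006, §4.3 Proposition and Corollary (pp. 38–39)] [cite: Bump1997, Prop. 4.2.3] -/
theorem commute_of_forall_commute_heckeOperator_fixedPoints (K : Subgroup G)
    (hfin : ∀ g : G, (orbit K (g : G ⧸ K)).Finite)
    (ρ : Representation k G V) (σ : ∀ t, Representation k G (W t)) [∀ t, (σ t).IsIrreducible]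
    (Ψ : V ≃ₗ[k] ⨁ t, W t) (hΨ : ∀ (g : G) (v : V) (t : ι), Ψ (ρ g v) t = σ t g (Ψ v t))
    (hdisj : ∀ s t, s ≠ t → ∀ φ : W s →ₗ[k] W t,
      (∀ w ∈ (σ s).fixedPoints K, φ w ∈ (σ t).fixedPoints K) →
      (∀ g : G, ∀ w ∈ (σ s).fixedPoints K, φ (heckeOperator (σ s) K g w) = heckeOperator (σ t) K g (φ w)) →
        ∀ w ∈ (σ s).fixedPoints K, φ w = 0)
    [FiniteDimensional k (ρ.fixedPoints K)]
    {x y : Module.End k (ρ.fixedPoints K)}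
    (hx : ∀ g, x * (heckeOperator ρ K g).restrict
        (fun _ hv => heckeOperator_apply_mem_fixedPoints ρ K g hv (hfin g)) =
      (heckeOperator ρ K g).restrict (fun _ hv => heckeOperator_apply_mem_fixedPoints ρ K g hv (hfin g)) * x)
    (hy : ∀ g, y * (heckeOperator ρ K g).restrict
        (fun _ hv => heckeOperator_apply_mem_fixedPoints ρ K g hv (hfin g)) =
      (heckeOperator ρ K g).restrict (fun _ hv => heckeOperator_apply_mem_fixedPoints ρ K g hv (hfin g)) * y) :
    x * y = y * x :=
  commute_of_forall_commute_heckeOperator_of_directSum K hfin ρ σ Ψ hΨ hdisj (ρ.fixedPoints K).subtype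
    Subtype.val_injective (Submodule.range_subtype _)
    (fun g => (heckeOperator ρ K g).restrict
      (fun _ hv => heckeOperator_apply_mem_fixedPoints ρ K g hv (hfin g)))
    (fun _ _ => rfl) hx hy

end Head

/-! ### Ed. 2: zero summands allowed («irreducible OR ZERO», the reading of [Liu2021, Def. 4.11] / Lemma D.1)

The head above asks every summand `σ_t` to be `IsIrreducible`, which a ZERO summand cannot be (Mathlib's `IsSimpleOrder`
needs `⊥ ≠ ⊤`).  In the application the summands are only «irreducible or zero» (`∀ U : Subrepresentation (σ t), U = ⊥ ∨ U = ⊤`,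
the body of the tree's `Liu2021.Def411AsPrinted.IsIrreducibleOrZero`).  The edition drops the zero summands
(`⊕_{t : ι} W_t ≃ ⊕_{t : ι, W_t ≠ 0} W_t`, `DirectSum.toModule` both ways) and applies the head on the subtype. -/

section IrreducibleOrZero

variable {k G V : Type*} [Field k] [CharZero k] [IsAlgClosed k] [Group G] [AddCommGroup V] [Module k V]
  {ι : Type*} {W : ι → Type*} [∀ t, AddCommGroup (W t)] [∀ t, Module k (W t)]
  {E : Type*} [AddCommGroup E] [Module k E] [FiniteDimensional k E]

omit [CharZero k] [IsAlgClosed k] in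
/-- On a NON-ZERO space, «every subrepresentation is `⊥` or `⊤`» is Mathlib's `Representation.IsIrreducible` (the tree's
`Liu2021.Def411AsPrinted.isIrreducible_of_nontrivial`, stated for a general field). [cite: BushnellHenniart2006, §4.3 Proposition and Corollary (pp. 38–39)] -/
private theorem isIrreducible_of_forall_eq_bot_or_eq_top {U : Type*} [AddCommGroup U] [Module k U] [Nontrivial U]
    (τ : Representation k G U) (h : ∀ S : Subrepresentation τ, S = ⊥ ∨ S = ⊤) : τ.IsIrreducible := by
  haveI : Nontrivial (Subrepresentation τ) := by
    refine ⟨⟨⊥, ⊤, fun hbt => ?_⟩⟩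
    have h' : ((⊥ : Subrepresentation τ) : Set U) = ((⊤ : Subrepresentation τ) : Set U) := by rw [hbt]
    obtain ⟨x, hx⟩ := exists_ne (0 : U)
    have hxtop : x ∈ ((⊤ : Subrepresentation τ) : Set U) := (Submodule.mem_top : x ∈ (⊤ : Submodule k U))
    rw [← h'] at hxtop
    exact hx ((Submodule.mem_bot k).1 hxtop)
  exact ⟨h⟩

omit [CharZero k] [IsAlgClosed k] in
/-- **Dropping the zero summands of a direct sum**: a linear equivalence `⊕_{t : ι} W_t ≃ ⊕_{t : {t // W_t ≠ 0}} W_t` whose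
`t₀`-component is the `t₀`-component (`DirectSum.toModule` in both directions; a summand that is not `Nontrivial` is `0`). [folklore] -/
private theorem exists_linearEquiv_directSum_subtype_nontrivial [DecidableEq ι] :
    ∃ e : (⨁ t, W t) ≃ₗ[k] ⨁ (t : {t : ι // Nontrivial (W t)}), W t.1,
      ∀ (x : ⨁ t, W t) (t₀ : {t : ι // Nontrivial (W t)}), e x t₀ = x t₀.1 := by
  classical
  let ι₀ := {t : ι // Nontrivial (W t)}
  let W₀ : ι₀ → Type _ := fun t => W t.1
  let drop : (⨁ t, W t) →ₗ[k] ⨁ (t : ι₀), W₀ t :=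
    DirectSum.toModule k ι _ fun t =>
      if h : Nontrivial (W t) then DirectSum.lof k ι₀ W₀ ⟨t, h⟩ else 0
  let keep : (⨁ (t : ι₀), W₀ t) →ₗ[k] ⨁ t, W t :=
    DirectSum.toModule k ι₀ _ fun t₀ => DirectSum.lof k ι W t₀.1
  have hdrop_pos : ∀ (t : ι) (h : Nontrivial (W t)) (w : W t),
      drop (DirectSum.lof k ι W t w) = DirectSum.lof k ι₀ W₀ ⟨t, h⟩ w := by
    intro t h w
    simp only [drop, DirectSum.toModule_lof, dif_pos h]
  have hdrop_neg : ∀ (t : ι), ¬ Nontrivial (W t) → ∀ w : W t, w = 0 := by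
    intro t h w
    haveI : Subsingleton (W t) := not_nontrivial_iff_subsingleton.1 h
    exact Subsingleton.elim _ _
  have h₁ : keep ∘ₗ drop = LinearMap.id := by
    refine DirectSum.linearMap_ext k (fun t => ?_)
    refine LinearMap.ext fun w => ?_
    simp only [LinearMap.comp_apply, LinearMap.id_comp]
    by_cases h : Nontrivial (W t)
    · rw [hdrop_pos t h w]
      simp only [keep, DirectSum.toModule_lof]
    · rw [hdrop_neg t h w, map_zero, map_zero, map_zero]
  have h₂ : drop ∘ₗ keep = LinearMap.id := by
    refine DirectSum.linearMap_ext k (fun t₀ => ?_)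
    refine LinearMap.ext fun w => ?_
    simp only [LinearMap.comp_apply, LinearMap.id_comp, keep, DirectSum.toModule_lof]
    exact hdrop_pos t₀.1 t₀.2 w
  refine ⟨LinearEquiv.ofLinear drop keep h₂ h₁, fun x t₀ => ?_⟩
  rw [LinearEquiv.ofLinear_apply]
  induction x using DirectSum.induction_on with
  | zero => rw [map_zero, DirectSum.zero_apply, DirectSum.zero_apply]
  | of t w =>
    rw [← DirectSum.lof_eq_of k]
    by_cases h : Nontrivial (W t)
    · rw [hdrop_pos t h w]
      by_cases ht : t = t₀.1
      · obtain ⟨t', ht'⟩ := t₀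
        subst ht
        rw [DirectSum.lof_apply, DirectSum.lof_apply]
      · have ht' : (⟨t, h⟩ : ι₀) ≠ t₀ := fun h' => ht (congrArg Subtype.val h')
        rw [DirectSum.lof_eq_of, DirectSum.of_eq_of_ne _ _ _ (Ne.symm ht'), DirectSum.lof_eq_of,
          DirectSum.of_eq_of_ne _ _ _ (Ne.symm ht)]
    · rw [hdrop_neg t h w, map_zero, map_zero, DirectSum.zero_apply, DirectSum.zero_apply]
  | add x y hx hy => rw [map_add, DirectSum.add_apply, DirectSum.add_apply, hx, hy]

/-- **Multiplicity one ⇒ the Hecke commutant on `V^K` is commutative — summands irreducible OR ZERO.**  The head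
`commute_of_forall_commute_heckeOperator_of_directSum` with the instance binder `[∀ t, (σ t).IsIrreducible]` replaced by the
weaker «every subrepresentation of `σ_t` is `⊥` or `⊤`» (`hirr`; zero summands allowed — the body of the tree's
`Liu2021.Def411AsPrinted.IsIrreducibleOrZero`, the reading of «irreducible» in [Liu2021, Def. 4.11 / Lemma D.1]).  Proof: drop
the zero summands (`exists_linearEquiv_directSum_subtype_nontrivial`) and apply the head over `{t // W_t ≠ 0}`, where `hirr`
gives `IsIrreducible`. [cite: BushnellHenniart2006, §4.3 Proposition and Corollary (pp. 38–39)] [cite: GoodmanWallachGTM255, §4.1.7 Lemma 4.1.18 (proof) and §4.1.2 Lemma 4.1.4]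
[cite: Bump1997, Prop. 4.2.3] -/
theorem commute_of_forall_commute_heckeOperator_of_directSum_of_isIrreducibleOrZero (K : Subgroup G)
    (hfin : ∀ g : G, (orbit K (g : G ⧸ K)).Finite)
    (ρ : Representation k G V) (σ : ∀ t, Representation k G (W t))
    (hirr : ∀ t, ∀ U : Subrepresentation (σ t), U = ⊥ ∨ U = ⊤)
    (Ψ : V ≃ₗ[k] ⨁ t, W t) (hΨ : ∀ (g : G) (v : V) (t : ι), Ψ (ρ g v) t = σ t g (Ψ v t))
    (hdisj : ∀ s t, s ≠ t → ∀ φ : W s →ₗ[k] W t,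
      (∀ w ∈ (σ s).fixedPoints K, φ w ∈ (σ t).fixedPoints K) →
      (∀ g : G, ∀ w ∈ (σ s).fixedPoints K, φ (heckeOperator (σ s) K g w) = heckeOperator (σ t) K g (φ w)) →
        ∀ w ∈ (σ s).fixedPoints K, φ w = 0)
    (b : E →ₗ[k] V) (hb : Function.Injective b) (hbK : LinearMap.range b = ρ.fixedPoints K)
    (T : G → Module.End k E) (hT : ∀ (g : G) (e : E), b (T g e) = heckeOperator ρ K g (b e))
    {x y : Module.End k E} (hx : ∀ g, x * T g = T g * x) (hy : ∀ g, y * T g = T g * y) :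
    x * y = y * x := by
  classical
  obtain ⟨e, he⟩ := exists_linearEquiv_directSum_subtype_nontrivial (k := k) (W := W)
  haveI hI : ∀ t₀ : {t : ι // Nontrivial (W t)}, (σ t₀.1).IsIrreducible := fun t₀ =>
    haveI := t₀.2
    isIrreducible_of_forall_eq_bot_or_eq_top (σ t₀.1) (hirr t₀.1)
  refine commute_of_forall_commute_heckeOperator_of_directSum K hfin ρ (fun t₀ : {t : ι // Nontrivial (W t)} => σ t₀.1)
    (Ψ.trans e) (fun g v t₀ => ?_) (fun s₀ t₀ hst => hdisj s₀.1 t₀.1 fun h => hst (Subtype.ext h)) b hb hbK T hT hx hy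
  rw [LinearEquiv.trans_apply, LinearEquiv.trans_apply, he, he, hΨ]

/-- The `Subalgebra.centralizer` form of `commute_of_forall_commute_heckeOperator_of_directSum_of_isIrreducibleOrZero`.
[cite: BushnellHenniart2006, §4.3 Proposition and Corollary (pp. 38–39)] [cite: GoodmanWallachGTM255, §4.1.7 Lemma 4.1.18 (proof)] -/
theorem centralizer_range_comm_of_directSum_of_isIrreducibleOrZero (K : Subgroup G)
    (hfin : ∀ g : G, (orbit K (g : G ⧸ K)).Finite)
    (ρ : Representation k G V) (σ : ∀ t, Representation k G (W t))
    (hirr : ∀ t, ∀ U : Subrepresentation (σ t), U = ⊥ ∨ U = ⊤)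
    (Ψ : V ≃ₗ[k] ⨁ t, W t) (hΨ : ∀ (g : G) (v : V) (t : ι), Ψ (ρ g v) t = σ t g (Ψ v t))
    (hdisj : ∀ s t, s ≠ t → ∀ φ : W s →ₗ[k] W t,
      (∀ w ∈ (σ s).fixedPoints K, φ w ∈ (σ t).fixedPoints K) →
      (∀ g : G, ∀ w ∈ (σ s).fixedPoints K, φ (heckeOperator (σ s) K g w) = heckeOperator (σ t) K g (φ w)) →
        ∀ w ∈ (σ s).fixedPoints K, φ w = 0)
    (b : E →ₗ[k] V) (hb : Function.Injective b) (hbK : LinearMap.range b = ρ.fixedPoints K)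
    (T : G → Module.End k E) (hT : ∀ (g : G) (e : E), b (T g e) = heckeOperator ρ K g (b e)) :
    ∀ x ∈ Subalgebra.centralizer k (Set.range T), ∀ y ∈ Subalgebra.centralizer k (Set.range T),
      x * y = y * x := by
  intro x hx y hy
  rw [Subalgebra.mem_centralizer_iff] at hx hy
  exact commute_of_forall_commute_heckeOperator_of_directSum_of_isIrreducibleOrZero K hfin ρ σ hirr Ψ hΨ hdisj b hb hbK
    T hT (fun g => (hx (T g) ⟨g, rfl⟩).symm) (fun g => (hy (T g) ⟨g, rfl⟩).symm)

end IrreducibleOrZero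

/-! ### Ed. 3: the separated form — `hdisj` discharged from «pairwise non-isomorphic» by `HeckeFixedVectorsLift`

The Hecke-disjointness hypothesis `hdisj` of the heads above is, for non-zero irreducible summands, the conclusion of the tree's
`eq_zero_of_heckeEquivariant_of_isEmpty_equiv` (Bushnell–Henniart §4.3 Corollary: non-isomorphic irreducibles are separated on
`K`-fixed vectors), and it is trivial when either summand is zero.  The edition states the head with `hdisj` replaced by the
SEPARATION hypothesis in the shape the application proves it (`hsep`: a non-zero summand admitting an equivariant linear
isomorphism onto another summand has the same index — the tree's `admTripleAll_UV_eq_of_equiv` shape). -/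

section Separated

variable {k G V : Type*} [Field k] [CharZero k] [IsAlgClosed k] [Group G] [AddCommGroup V] [Module k V]
  {ι : Type*} {W : ι → Type*} [∀ t, AddCommGroup (W t)] [∀ t, Module k (W t)]
  {E : Type*} [AddCommGroup E] [Module k E] [FiniteDimensional k E]

omit [IsAlgClosed k] in
/-- **Hecke-disjointness from separation.**  If the summands are «irreducible or zero» and pairwise separated (`hsep`), then for
`s ≠ t` every linear `φ : W_s → W_t` carrying `W_s^K` Hecke-equivariantly into `W_t^K` vanishes on `W_s^K`: trivial if `W_s = 0` or
`W_t = 0`, and `eq_zero_of_heckeEquivariant_of_isEmpty_equiv` otherwise. [cite: BushnellHenniart2006, §4.3 Proposition and Corollary (pp. 38–39)] -/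
theorem heckeDisjoint_of_separated (K : Subgroup G) (hfin : ∀ g : G, (orbit K (g : G ⧸ K)).Finite)
    (σ : ∀ t, Representation k G (W t)) (hirr : ∀ t, ∀ U : Subrepresentation (σ t), U = ⊥ ∨ U = ⊤)
    (hsep : ∀ s t, Nontrivial (W s) →
      (∃ f : W s ≃ₗ[k] W t, ∀ (g : G) (v : W s), f (σ s g v) = σ t g (f v)) → s = t) :
    ∀ s t, s ≠ t → ∀ φ : W s →ₗ[k] W t,
      (∀ w ∈ (σ s).fixedPoints K, φ w ∈ (σ t).fixedPoints K) →
      (∀ g : G, ∀ w ∈ (σ s).fixedPoints K, φ (heckeOperator (σ s) K g w) = heckeOperator (σ t) K g (φ w)) →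
        ∀ w ∈ (σ s).fixedPoints K, φ w = 0 := by
  intro s t hst φ hφK hφT w hw
  by_cases hs : Nontrivial (W s)
  swap
  · haveI : Subsingleton (W s) := not_nontrivial_iff_subsingleton.1 hs
    rw [Subsingleton.elim w 0, map_zero]
  by_cases ht : Nontrivial (W t)
  swap
  · haveI : Subsingleton (W t) := not_nontrivial_iff_subsingleton.1 ht
    exact Subsingleton.elim _ _
  haveI := isIrreducible_of_forall_eq_bot_or_eq_top (σ s) (hirr s)
  haveI := isIrreducible_of_forall_eq_bot_or_eq_top (σ t) (hirr t)
  have hne : IsEmpty ((σ s).Equiv (σ t)) :=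
    ⟨fun e => hst (hsep s t hs ⟨e.toLinearEquiv, fun g v => by
      rw [Representation.Equiv.toLinearEquiv_apply, Representation.Equiv.toLinearEquiv_apply]
      exact Representation.IntertwiningMap.isIntertwining (σ s) (σ t) e.toIntertwiningMap g v⟩)⟩
  exact eq_zero_of_heckeEquivariant_of_isEmpty_equiv (σ s) (σ t) K hfin hne φ hφK hφT w hw

/-- **Multiplicity one ⇒ the Hecke commutant on `V^K` is commutative — separated form.**  `V ≃ ⊕_t W_t` `G`-equivariantly with
summands irreducible or zero (`hirr`) and pairwise SEPARATED (`hsep`: a non-zero `W_s` equivariantly isomorphic to `W_t` forces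
`s = t`); then on any finite-dimensional model `(E, b, T)` of `V^K` with its Hecke operators, endomorphisms commuting with every `T g`
commute (`commute_of_forall_commute_heckeOperator_of_directSum_of_isIrreducibleOrZero` + `heckeDisjoint_of_separated`).  This is
the form the CM-Albanese road applies to `H¹(A_K(ℂ); ℂ)` with [Liu2021, Prop. 4.13]'s decomposition and Thm. 4.18 (2)'s
non-isomorphy. [cite: BushnellHenniart2006, §4.3 Proposition and Corollary (pp. 38–39)] [cite: GoodmanWallachGTM255, §4.1.7 Lemma 4.1.18 (proof) and §4.1.2 Lemma 4.1.4]
[cite: Bump1997, Prop. 4.2.3] -/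
theorem commute_of_forall_commute_heckeOperator_of_directSum_of_separated (K : Subgroup G)
    (hfin : ∀ g : G, (orbit K (g : G ⧸ K)).Finite)
    (ρ : Representation k G V) (σ : ∀ t, Representation k G (W t))
    (hirr : ∀ t, ∀ U : Subrepresentation (σ t), U = ⊥ ∨ U = ⊤)
    (hsep : ∀ s t, Nontrivial (W s) →
      (∃ f : W s ≃ₗ[k] W t, ∀ (g : G) (v : W s), f (σ s g v) = σ t g (f v)) → s = t)
    (Ψ : V ≃ₗ[k] ⨁ t, W t) (hΨ : ∀ (g : G) (v : V) (t : ι), Ψ (ρ g v) t = σ t g (Ψ v t))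
    (b : E →ₗ[k] V) (hb : Function.Injective b) (hbK : LinearMap.range b = ρ.fixedPoints K)
    (T : G → Module.End k E) (hT : ∀ (g : G) (e : E), b (T g e) = heckeOperator ρ K g (b e))
    {x y : Module.End k E} (hx : ∀ g, x * T g = T g * x) (hy : ∀ g, y * T g = T g * y) :
    x * y = y * x :=
  commute_of_forall_commute_heckeOperator_of_directSum_of_isIrreducibleOrZero K hfin ρ σ hirr Ψ hΨ
    (heckeDisjoint_of_separated K hfin σ hirr hsep) b hb hbK T hT hx hy

/-- The `Subalgebra.centralizer` form of `commute_of_forall_commute_heckeOperator_of_directSum_of_separated`.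
[cite: BushnellHenniart2006, §4.3 Proposition and Corollary (pp. 38–39)] [cite: GoodmanWallachGTM255, §4.1.7 Lemma 4.1.18 (proof)] -/
theorem centralizer_range_comm_of_directSum_of_separated (K : Subgroup G)
    (hfin : ∀ g : G, (orbit K (g : G ⧸ K)).Finite)
    (ρ : Representation k G V) (σ : ∀ t, Representation k G (W t))
    (hirr : ∀ t, ∀ U : Subrepresentation (σ t), U = ⊥ ∨ U = ⊤)
    (hsep : ∀ s t, Nontrivial (W s) →
      (∃ f : W s ≃ₗ[k] W t, ∀ (g : G) (v : W s), f (σ s g v) = σ t g (f v)) → s = t)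
    (Ψ : V ≃ₗ[k] ⨁ t, W t) (hΨ : ∀ (g : G) (v : V) (t : ι), Ψ (ρ g v) t = σ t g (Ψ v t))
    (b : E →ₗ[k] V) (hb : Function.Injective b) (hbK : LinearMap.range b = ρ.fixedPoints K)
    (T : G → Module.End k E) (hT : ∀ (g : G) (e : E), b (T g e) = heckeOperator ρ K g (b e)) :
    ∀ x ∈ Subalgebra.centralizer k (Set.range T), ∀ y ∈ Subalgebra.centralizer k (Set.range T),
      x * y = y * x := by
  intro x hx y hy
  rw [Subalgebra.mem_centralizer_iff] at hx hy
  exact commute_of_forall_commute_heckeOperator_of_directSum_of_separated K hfin ρ σ hirr hsep Ψ hΨ b hb hbK T hT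
    (fun g => (hx (T g) ⟨g, rfl⟩).symm) (fun g => (hy (T g) ⟨g, rfl⟩).symm)

end Separated

end Literature.NumberTheory.Automorphic

end
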